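import Summits.QuantumFields.GaugeBoot.DiagonalRPTorusRestPartition
import Literature.MathematicalPhysics.QuantumFieldTheory.StrongCouplingTorusSystem
import HarnessLib

/-!
# Rest expectations are expectations of the torus plaquette system (gauge-boot, L3 `d = 3` uniform
# window, brick 2a: the dictionary)

HONEST FRAMING (cell `pub-gaugeboot`, page 1 of every file): the venture produces certified bounds
on lattice expectations at stated coupling, gauge group, dimension and torus size; NOT a mass gap,
NOT a continuum limit, NOT a string tension; NOT Yang–Mills-summit-bearing (barriers
`FixedCouplingUltralocality`, `PerturbativeInvisibility`). This module is bookkeeping for the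
structural NEGATIVE results on diagonal reflection positivity of tori (the half-action trick of
`DiagonalRPTorusHalfAction` weighs the product-Haar integral by the Boltzmann factors of the REST
plaquettes only); it discharges nothing by itself.

## Content (torus `(ℤ/L)^d`, compact metrisable `G`, continuous `ρ`, real `β`)

For a finite set `V` of plaquettes (the plaquettes "switched on"; in the application
`V = DiagRPTube.restPlaqs i j h`) and real observables `f, g`:

* `restNum V f = ∫ f ∏_{q ∈ V} e^{β Re tr ρ(U_q)} ∏ dU`, `restExpect V f = restNum V f / restZ V`
  (`DiagRPUnif.restZ` of `DiagonalRPTorusRestPartition`), the truncated correlation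
  `restTrunc V f g = ⟨fg⟩_V - ⟨f⟩_V ⟨g⟩_V` (`restExpect_one`, `restExpect_sub`);
  `DiagRPTube.trickForm ρ i j h β A` is `restNum (restPlaqs i j h) (A∘Θ · A)`
  (`trickForm_eq_restNum`).
* ★ **THE DICTIONARY** `ofReal_restExpect_eq_expect` / `restExpect_eq_re_expect` /
  `ofReal_restTrunc_eq`: reading torus configurations on the fundamental domain of `ℤ^d`
  (`torusSigma`, `map_torusSigma_zdHaar` of `StrongCouplingTorusSystem`), `⟨f⟩_V` is the
  expectation `(torusSystem ρ L).expect (f ∘ torusSigma L) (V.image tlab) β` of the Literature's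
  ABSTRACT PLAQUETTE SYSTEM of the torus with exactly the labels of `V` switched on
  (`tlab q = (x, i, j)` for the genuine plaquette `q = (x; i < j)`, `tbonds_tlab`: its bonds are
  the four links `DiagRPUnif.plinks q`; the costs `N - Re tr` and `-Re tr` differ by the constant
  `e^{-βN·#V}`, which cancels, `numZ_image_tlab`).

The sequel `DiagonalRPTorusRestClustering` transports the Literature's uniform clustering
(`PlaqSystem.norm_truncatedExpect_le`) through this dictionary. Elementary given the Literature
layer (Osterwalder–Seiler, Ann. Phys. 110 (1978) 440, §§2–3; Seiler, LNP 159 (1982) Ch. 2–3);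
no named fact.
-/

open MeasureTheory Finset Function

namespace Summit.QuantumFields.GaugeBoot

open Literature.MathematicalPhysics.QuantumFieldTheory

noncomputable section

namespace DiagRPUnif

open DiagRPTube

variable {d L : ℕ} [NeZero L] {N : ℕ} {G : Type*} [Group G] [TopologicalSpace G]
  [IsTopologicalGroup G] [CompactSpace G] [MeasurableSpace G] [BorelSpace G]
  [SecondCountableTopology G] (ρ : G →* Matrix (Fin N) (Fin N) ℂ) (β : ℝ)

/-! ## Rest expectations -/

/-- The un-normalised REST EXPECTATION `∫ f ∏_{q ∈ V} e^{β Re tr ρ(U_q)} ∏ dU`. -/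
def restNum (V : Finset (Plaquette d L)) (f : GaugeConfig d L G → ℝ) : ℝ :=
  ∫ U, f U * ∏ q ∈ V, Real.exp (β * WilsonRP.plaqRe ρ U q)
    ∂Measure.pi fun _ : Edge d L => haarProbability G

/-- The REST EXPECTATION `⟨f⟩_V = restNum V f / restZ V`. -/
def restExpect (V : Finset (Plaquette d L)) (f : GaugeConfig d L G → ℝ) : ℝ :=
  restNum ρ β V f / restZ ρ β V

/-- The TRUNCATED rest correlation `⟨fg⟩_V - ⟨f⟩_V ⟨g⟩_V`. -/
def restTrunc (V : Finset (Plaquette d L)) (f g : GaugeConfig d L G → ℝ) : ℝ :=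
  restExpect ρ β V (fun U => f U * g U) - restExpect ρ β V f * restExpect ρ β V g

omit [SecondCountableTopology G] in
/-- `restNum V 1 = restZ V`. -/
theorem restNum_one (V : Finset (Plaquette d L)) : restNum ρ β V (fun _ => 1) = restZ ρ β V := by
  simp [restNum, restZ]

/-- `⟨1⟩_V = 1`. -/
theorem restExpect_one (hρ : Continuous ρ) (V : Finset (Plaquette d L)) :
    restExpect ρ β V (fun _ => 1) = 1 := by
  rw [restExpect, restNum_one, div_self (restZ_pos ρ β hρ V).ne']

/-- `restNum` is linear: subtraction. -/
theorem restNum_sub (hρ : Continuous ρ) (V : Finset (Plaquette d L))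
    {f g : GaugeConfig d L G → ℝ}
    (hfm : Measurable f) (hgm : Measurable g) {Cf Cg : ℝ} (hfb : ∀ U, |f U| ≤ Cf)
    (hgb : ∀ U, |g U| ≤ Cg) :
    restNum ρ β V (fun U => f U - g U) = restNum ρ β V f - restNum ρ β V g := by
  unfold restNum
  have hw := continuous_expProd ρ β hρ V
  obtain ⟨K, hK⟩ : ∃ K, ∀ U : GaugeConfig d L G,
      ∏ q ∈ V, Real.exp (β * WilsonRP.plaqRe ρ U q) ≤ K := by
    obtain ⟨K, hK⟩ := (isCompact_range hw).isBounded.subset_closedBall 0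
    exact ⟨K, fun U => by
      have := hK ⟨U, rfl⟩
      rw [Metric.mem_closedBall, dist_zero_right, Real.norm_eq_abs] at this
      exact (le_abs_self _).trans this⟩
  have hint : ∀ {u : GaugeConfig d L G → ℝ}, Measurable u → ∀ {C : ℝ}, (∀ U, |u U| ≤ C) →
      Integrable (fun U => u U * ∏ q ∈ V, Real.exp (β * WilsonRP.plaqRe ρ U q))
        (Measure.pi fun _ : Edge d L => haarProbability G) := by
    intro u hum C huC
    refine Integrable.of_bound (hum.mul hw.measurable).aestronglyMeasurable (C * K)
      (ae_of_all _ fun U => ?_)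
    rw [Real.norm_eq_abs, abs_mul,
      abs_of_nonneg (Finset.prod_nonneg fun _ _ => (Real.exp_pos _).le)]
    exact mul_le_mul (huC U) (hK U) (Finset.prod_nonneg fun _ _ => (Real.exp_pos _).le)
      ((abs_nonneg _).trans (huC U))
  rw [← integral_sub (hint hfm hfb) (hint hgm hgb)]
  refine integral_congr_ae (ae_of_all _ fun U => ?_)
  simp only
  ring

/-- `⟨f - g⟩_V = ⟨f⟩_V - ⟨g⟩_V`. -/
theorem restExpect_sub (hρ : Continuous ρ) (V : Finset (Plaquette d L))
    {f g : GaugeConfig d L G → ℝ} (hfm : Measurable f) (hgm : Measurable g) {Cf Cg : ℝ}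
    (hfb : ∀ U, |f U| ≤ Cf) (hgb : ∀ U, |g U| ≤ Cg) :
    restExpect ρ β V (fun U => f U - g U) = restExpect ρ β V f - restExpect ρ β V g := by
  rw [restExpect, restNum_sub ρ β hρ V hfm hgm hfb hgb, sub_div]
  rfl

omit [SecondCountableTopology G] in
/-- The trick form of `DiagonalRPTorusHalfAction` is an un-normalised rest expectation. -/
theorem trickForm_eq_restNum (i j : Fin d) (h : ℕ) (A : GaugeConfig d L G → ℝ) :
    trickForm ρ i j h β A =
      restNum ρ β (restPlaqs i j h) fun U => A (configDiagSwap i j U) * A U :=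
  rfl

/-! ## The dictionary with the torus plaquette system -/

/-- The label of a genuine plaquette `(x; i < j)` in the torus plaquette system: `(x, i, j)`. -/
def tlab (q : Plaquette d L) : TPlaq d L := (q.1, q.2.1.1, q.2.1.2)

omit [NeZero L] in
/-- `tlab` is injective. -/
theorem tlab_injective : Injective (tlab : Plaquette d L → TPlaq d L) := by
  rintro ⟨x, ⟨⟨i, j⟩, hij⟩⟩ ⟨x', ⟨⟨i', j'⟩, hij'⟩⟩ h
  simp only [tlab, Prod.mk.injEq] at h
  obtain ⟨rfl, rfl, rfl⟩ := h
  rfl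

omit [NeZero L] in
/-- The bonds of the label of `q` are the four links of `q`. -/
theorem tbonds_tlab (q : Plaquette d L) : (tlab q).tbonds = plinks q := by
  ext e
  simp only [tlab, TPlaq.tbonds, mem_insert, mem_singleton, mem_plinks, HasLink]
  constructor
  · rintro (rfl | rfl | rfl | rfl)
    · exact ⟨0, rfl⟩
    · exact ⟨1, rfl⟩
    · exact ⟨2, rfl⟩
    · exact ⟨3, rfl⟩
  · rintro ⟨a, rfl⟩
    fin_cases a
    · exact Or.inl rfl
    · exact Or.inr (Or.inl rfl)
    · exact Or.inr (Or.inr (Or.inl rfl))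
    · exact Or.inr (Or.inr (Or.inr rfl))

omit [NeZero L] [TopologicalSpace G] [IsTopologicalGroup G] [CompactSpace G]
  [MeasurableSpace G] [BorelSpace G] [SecondCountableTopology G] in
/-- The torus cost of the label of `q` is `N - Re tr ρ(U_q)` read through the section. -/
theorem torusCost_tlab (q : Plaquette d L) (U : ZdGaugeConfig d G) :
    torusCost ρ L (tlab q) U = N - WilsonRP.plaqRe ρ (torusSigma L U) q := rfl

/-- **The un-normalised dictionary**:
`numZ (f ∘ σ) (V.image tlab) β = e^{-βN·#V} · restNum V f`. -/
theorem numZ_image_tlab (hρ : Continuous ρ) (V : Finset (Plaquette d L))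
    {f : GaugeConfig d L G → ℝ} (hfm : Measurable f) :
    (torusSystem ρ L).numZ (fun U => ((f (torusSigma L U) : ℝ) : ℂ)) (V.image tlab) (β : ℂ) =
      ((Real.exp (-(β * N * V.card)) * restNum ρ β V f : ℝ) : ℂ) := by
  rw [PlaqSystem.numZ_eq_integral_exp]
  -- the integrand is a real function of `torusSigma L U`
  set g : GaugeConfig d L G → ℝ := fun W =>
    f W * ∏ q ∈ V, Real.exp (β * WilsonRP.plaqRe ρ W q) with hg
  have hsum : ∀ U : ZdGaugeConfig d G,
      ∑ p ∈ V.image tlab, ((torusSystem ρ L).cost p U : ℂ) =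
        ((∑ q ∈ V, ((N : ℝ) - WilsonRP.plaqRe ρ (torusSigma L U) q) : ℝ) : ℂ) := by
    intro U
    rw [sum_image fun q _ q' _ hqq' => tlab_injective hqq', Complex.ofReal_sum]
    rfl
  have hpt : ∀ U : ZdGaugeConfig d G,
      ((f (torusSigma L U) : ℝ) : ℂ) *
          Complex.exp (-((β : ℂ) * ∑ p ∈ V.image tlab, ((torusSystem ρ L).cost p U : ℂ))) =
        (((Real.exp (-(β * N * V.card)) * g (torusSigma L U) : ℝ)) : ℂ) := by
    intro U
    rw [hsum, ← Complex.ofReal_mul, ← Complex.ofReal_neg, ← Complex.ofReal_exp,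
      ← Complex.ofReal_mul, hg]
    congr 1
    simp only [sum_sub_distrib, sum_const, nsmul_eq_mul]
    rw [show -(β * (↑V.card * ↑N - ∑ q ∈ V, WilsonRP.plaqRe ρ (torusSigma L U) q)) =
        -(β * N * V.card) + ∑ q ∈ V, β * WilsonRP.plaqRe ρ (torusSigma L U) q by
      rw [← mul_sum]; ring, Real.exp_add, Real.exp_sum]
    ring
  simp_rw [hpt]
  rw [integral_complex_ofReal]
  congr 1
  rw [integral_const_mul]
  congr 1
  -- change of variables through the section
  have hgm : Measurable g := hfm.mul (continuous_expProd ρ β hρ V).measurable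
  rw [restNum, ← hg, ← map_torusSigma_zdHaar (d := d) (G := G) (L := L),
    integral_map (measurable_torusSigma L).aemeasurable hgm.aestronglyMeasurable]

/-- ★ **THE DICTIONARY**: the rest expectation is the expectation of the torus plaquette system
with the labels of `V` switched on (as a complex number). -/
theorem ofReal_restExpect_eq_expect (hρ : Continuous ρ) (V : Finset (Plaquette d L))
    {f : GaugeConfig d L G → ℝ} (hfm : Measurable f) :
    ((restExpect ρ β V f : ℝ) : ℂ) =
      (torusSystem ρ L).expect (fun U => ((f (torusSigma L U) : ℝ) : ℂ)) (V.image tlab)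
        (β : ℂ) := by
  rw [PlaqSystem.expect, PlaqSystem.partZ, numZ_image_tlab ρ β hρ V hfm]
  have h1 := numZ_image_tlab ρ β hρ V (f := fun _ => (1 : ℝ)) measurable_const
  simp only [Complex.ofReal_one] at h1
  rw [h1, restNum_one, ← Complex.ofReal_div, restExpect,
    mul_div_mul_left _ _ (Real.exp_pos _).ne']

/-- The dictionary, real form. -/
theorem restExpect_eq_re_expect (hρ : Continuous ρ) (V : Finset (Plaquette d L))
    {f : GaugeConfig d L G → ℝ} (hfm : Measurable f) :
    restExpect ρ β V f = ((torusSystem ρ L).expect (fun U => ((f (torusSigma L U) : ℝ) : ℂ))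
      (V.image tlab) (β : ℂ)).re := by
  rw [← ofReal_restExpect_eq_expect ρ β hρ V hfm, Complex.ofReal_re]

/-- **The truncated correlation through the dictionary.** -/
theorem ofReal_restTrunc_eq (hρ : Continuous ρ) (V : Finset (Plaquette d L))
    {f g : GaugeConfig d L G → ℝ} (hfm : Measurable f) (hgm : Measurable g) :
    ((restTrunc ρ β V f g : ℝ) : ℂ) =
      (torusSystem ρ L).expect
          (fun U => ((f (torusSigma L U) : ℝ) : ℂ) * ((g (torusSigma L U) : ℝ) : ℂ))
          (V.image tlab) (β : ℂ) -
        (torusSystem ρ L).expect (fun U => ((f (torusSigma L U) : ℝ) : ℂ)) (V.image tlab)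
            (β : ℂ) *
          (torusSystem ρ L).expect (fun U => ((g (torusSigma L U) : ℝ) : ℂ)) (V.image tlab)
            (β : ℂ) := by
  rw [restTrunc, Complex.ofReal_sub, Complex.ofReal_mul,
    ofReal_restExpect_eq_expect ρ β hρ V hfm,
    ofReal_restExpect_eq_expect ρ β hρ V hgm,
    ofReal_restExpect_eq_expect ρ β hρ V (f := fun U => f U * g U) (hfm.mul hgm)]
  simp only [Complex.ofReal_mul]

end DiagRPUnif

end

end Summit.QuantumFields.GaugeBoot
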